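import Literature.MathematicalPhysics.QuantumFieldTheory.Balaban1983to89.B9Cor36GpDirBoundaryLetters

/-!
# `Balaban1983to89.B9Cor36GpDirEntriesAtField` — [Balaban1985BackgroundPropagators] Cor. 3.6 p. 408 ON ROAD P4 (print's Dirichlet cube letter, the (β) knit legs):
# THE FOUR (3.42) ENTRIES OF `G′_□(Uᵘ) = Ω₀(padΔ_{□,Ω₀}(Uᵘ))⁻¹Ω₀` WITH THE DERIVATIVES `∇_{Uᵘ}`, `∇*_{Uᵘ}`, `Δ_{Uᵘ}` OF THE WHOLE TORUS, OVER THE CUBE SEQUENCE's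
# BLOCKS — the cube-side twin of the head's displayed row `h36b` — sub-row G-B9-LETTERS (site sector), seat dag-n06-c g32 UNIT 8b

statement-level skeleton of published theorems with citation tags; proofs where landed; nothing here is a claim about the Yang–Mills mass gap

CITATION HEADER (lean-in-tree rule).  B9 = T. Bałaban, *Propagators for lattice gauge theories in a background field*, Commun. Math. Phys. **99** (1985)
389–434 [Balaban1985BackgroundPropagators] (held `paper:balaban1985-cmp99-background-propagators`; journal page = PDF page + 388): p. 407 l. 39 – p. 408 l. 11
(«Applying the gauge transformation u we get U′ = Uᵘ = e^{iηA} with A satisfying the inequalities in (3.35) for j = k. This implies that U′ satisfies (3.37) for the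
sequence {Ω′_j} with U = 1 and α₁ = O(1)Mα₀. Assuming O(1)Mα₀ ≦ a₁ we can apply the above Corollary and we get Corollary 3.6. … This follows from Corollary 3.5
applied to the configuration U′ = Uᵘ, and we have to recall only that all the results of these theorems are gauge invariant.»); Thm 3.1 (3.42) p. 397 («|G′(U)(x,y)|, |∇_U G′|, |G′∇*_U|, |Δ_U G′| ≤ …»); p. 394 l. 24–33 (Dirichlet conditions on `Ω₀`); (3.3) p. 390, (3.8) p. 392, (3.23)–(3.25)
p. 394; p. 403 l. 1–9, (3.70) p. 404 (the defect `∇_{U′} − ∇_1`); p. 408 (last lines) – p. 409 l. 5 (the collars, «Ω₀(□) ⊂ □⁵»).  [4] = [Balaban1984PropagatorsII] (2.51)–(2.55)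
p. 232, Lemma 2.1 (2.61) p. 234.  Rows B9.Cor3.6 × B9.Thm3.1(3.42) (cells only; no row head changes).

WHY THIS FILE (road P4 of the N06 h36b campaign; UNITS 1–8a of this seat).  UNIT 7 (`B9Cor36GpDirExtAtField.gpDir_cube_at_field`) is Theorem 3.4 at the padded
Dirichlet letter for the small field `Ṽ = Uᵘ·𝟙[bond ⊂ Ω₀(□)]` of a (3.35) datum covering `Ω₀(□)`: `G := conj b(η²(padΔ_{□,Ω₀}(Ṽ))⁻¹) ≺ B(Lⁿη)²e^{−δd}` with the two
transfer clauses, `padΔ(Ṽ) = padΔ(Uᵘ)`.  UNIT 8a rewrites the head's words in `O := G′_□(Uᵘ) = (padΔ)⁻¹ − (1 − Ω₀)` as padded-inverse words plus boundary words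
(rows of cube level `0`).  This file bounds every piece in [4]'s block-majorant calculus over the cube sequence's geometry, exactly as r05's `B9Cor36GpCubeEntriesAtV` §5 does for
the whole-torus letter: the padded-inverse words by the EntriesAtV method with the defect multipliers of `Uᵘ` bounded row by row by `2(Lⁿη)⁻¹` (UNIT 8a §3 — small on the bonds
inside `Ω₀(□)`, level `0` elsewhere), the boundary words by row-local factors (`η ≤ Lⁿη`; on rows off `Ω₀`, `η = L⁰η`) times one shift, and the Laplacian entry through
`Δ_U O = Ω₀ − Ω₀·avg·O + flux` with `avg(Uᵘ) = avg(Ṽ)` at the knit legs (UNIT 8a) and r05's block-local size of the averaging operator.  Output: the four (3.42) shapes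
`B_f(Lⁿη)²e^{−δd}`, `B_fLⁿηe^{−δd}`, `B_fLⁿηe^{−δd}`, `B_f·1·e^{−δd}` for `conj b(η²O)`, `conj b(∇_{Uᵘ,μ})conj b(η²O)`, `conj b(η²O)conj b(−∇*_{Uᵘ,μ})`, `conj b(η⁻²Δ_{Uᵘ})conj b(η²O)` —
the cube-side form of the head's `h36b` at `Uᵘ`; the member-side reading (gauge invariance `O(U) = R(u)⁻¹O(Uᵘ)R(u)` + r05's sandwich transfer to the member's blocks) is UNIT 10.

HYPOTHESES DISPLAYED, NOT DISCHARGED HERE: the (3.35) datum box `Q ⊇ chart⁻¹Ω₀(□)` with its constants (LOCATED-32 of this seat: supplied by the route's regime only after a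
decision on the class-cube size ∕ collars), the 2-step stencil geometry `hS2` of `Ω₀(□)` (g31's mirror box; a separate geometry unit), the bi-contractivity of the rotations
`R(Uᵘ_μ(z))^{±1}` (G-valued `U`, `u`: `norm_R_le_of_mem_unitaryUnits`), p06's window numerics for the knit legs.

WHAT IS PROVED (0 `def`s; 0 sorry; 0 new named facts; standard axioms): ★★★`gpDir_cube_entries_at_field` (§1).
-/

noncomputable section

namespace Literature.MathematicalPhysics.QuantumFieldTheory.Balaban1983to89.B9Cor36GpDirEntriesAtField

open Literature.MathematicalPhysics.QuantumFieldTheory.Balaban1983to89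
open Literature.MathematicalPhysics.QuantumFieldTheory.Balaban1983to89.B6RandomWalk (HasMajorant hasMajorant_mono hasMajorant_add Triangle254 Ineq261 c1_nonneg)
open Literature.MathematicalPhysics.QuantumFieldTheory.Balaban1983to89.B9Thm34Ext (toB6)
open Literature.MathematicalPhysics.QuantumFieldTheory.Balaban1983to89.B9Eq352DivFormLetters (conj conj_sub)
open Literature.MathematicalPhysics.QuantumFieldTheory.Balaban1983to89.B9Eq352GradLetters (diffLetter conj_add)
open Literature.MathematicalPhysics.QuantumFieldTheory.Balaban1983to89.B9Eq39Adjoint (R fluct covD)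
open Literature.MathematicalPhysics.QuantumFieldTheory.Balaban1983to89.B9Eq352DivForm (tauB)
open Literature.MathematicalPhysics.QuantumFieldTheory.Balaban1983to89.B6KLevelCensusIndexV1 (KIdx kGeo)
open Literature.MathematicalPhysics.QuantumFieldTheory.Balaban1983to89.B6Cover236MultiLevelBlocks (cubes)
open Literature.MathematicalPhysics.QuantumFieldTheory.Balaban1983to89.B6GlobalChartV1 (PV boxEquiv)
open Literature.MathematicalPhysics.QuantumFieldTheory.Balaban1983to89.B9BackgroundsKLevelV1 (shiftsV1)
open Literature.MathematicalPhysics.QuantumFieldTheory.Balaban1983to89.B9Eq360DeltaPrimeAY (AfldY chartA chartA_apply)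
open Literature.MathematicalPhysics.QuantumFieldTheory.Balaban1983to89.B9Eq360DeltaPrimeACubeY (blkCubeY)
open Literature.MathematicalPhysics.QuantumFieldTheory.Balaban1983to89.B9CubeLettersOpsL0 (oddMh cubeFamY levCubeY)
open Literature.MathematicalPhysics.QuantumFieldTheory.Balaban1983to89.B9CubeLettersBondOpsL0 (BlkCubeY)
open Literature.MathematicalPhysics.QuantumFieldTheory.Balaban1983to89.B9CubeGeometryInputs (geoCK geoCK_len geoCK_eta geoCK_eta_pos geoCK_len_pos geoCK_len_blkCubeY
  geoCK_eta_le_len geoCK_dist_axioms geoCK_site_nonempty RM1 N1 hST_geoCK exists_h261_geoCK)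
open Literature.MathematicalPhysics.QuantumFieldTheory.Balaban1983to89.B9Cor35GpCubeInputsAtOne (hasMajorant_shift_mul_weighted)
open Literature.MathematicalPhysics.QuantumFieldTheory.Balaban1983to89.B9Cor35GpAtCubeLetters (hasMajorant_weaken)
open Literature.MathematicalPhysics.QuantumFieldTheory.Balaban1983to89.B9Cor35GpDirInputsAtOne (dirDomY GpDirK)
open Literature.MathematicalPhysics.QuantumFieldTheory.Balaban1983to89.B9Cor36GpCubeEntriesAtV (shiftOpY shiftOpY' mulDefF mulDefB diffLetter_inl_eq_add diffLetter_inr_eq_sub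
  hasMajorant_conj_shiftOpY hasMajorant_conj_shiftOpY' hasMajorant_weighted_mul_shift hasMajorant_one_decay norm_avgCube_apply_le)
open Literature.MathematicalPhysics.QuantumFieldTheory.Balaban1983to89.B9Cor36SiteSandwichTransfer (rowLocal_conj_of_local hasMajorant_mul_of_rowLocal
  hasMajorant_mul_of_rowLocal_right)
open Literature.MathematicalPhysics.QuantumFieldTheory.Balaban1983to89.B9Cor36GpDirExtAtField (GpDirVK gpDir_cube_at_field hasMajorant_GpDirVK)
open Literature.MathematicalPhysics.QuantumFieldTheory.Balaban1983to89.B9Cor36GpDirBoundaryLetters (exMul rotF rotB avgOpY GinvY norm_exMul_apply_le' exMul_apply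
  norm_rotF_apply_le norm_rotB_apply_le conj_O_eq conj_diffLetter_inl_mul_O_eq conj_O_mul_diffLetter_inr_eq conj_lapSL_mul_O_eq norm_mulDefF_apply_le_two
  norm_mulDefB_apply_le_two avgOpY_cutCfgS_eq_gaugeY)
open Literature.MathematicalPhysics.QuantumFieldTheory.Balaban1983to89.B9Eq359CubeKernelsKnitAtOne (CqK CqK_nonneg)
open Literature.MathematicalPhysics.QuantumFieldTheory.Balaban1983to89.B9Eq337CutFieldDirY (cutFldS cutCfgS chartA_cutFldS cutAc_apply_of UboxY_cutCfgS UboxY_cutCfgS_of_mem)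
open Literature.MathematicalPhysics.QuantumFieldTheory.Balaban1983to89.B9CubeSequence408Mirrors (mem_dirDomC_of_lev_pos)
open Literature.MathematicalPhysics.QuantumFieldTheory.Balaban1983to89.B9Cor36CutoffField337 (tauB_one_apply)
open Literature.MathematicalPhysics.QuantumFieldTheory.Balaban1983to89.B9Ineq386CommSum (hasMajorant_sum_const)
open Literature.MathematicalPhysics.QuantumFieldTheory.Balaban1983to89.B7Prop2Explicit (C0 c2')
open Literature.MathematicalPhysics.QuantumFieldTheory.Balaban1983to89.B7Prop3Flat (c3)
open Literature.MathematicalPhysics.QuantumFieldTheory.Balaban1983to89.Node00 (SiteY CfgY GaugeY SiteParY toKT shiftY gaugeY UboxY lapSL)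
open Literature.MathematicalPhysics.QuantumFieldTheory.Balaban1983to89.Node00.OpsYLocalInverse (cubeProjY cubeProjY_apply)
open Literature.MathematicalPhysics.QuantumFieldTheory.Balaban1983to89.Node00.OpsYCubeDirInverse (padDeltaCubeY GpDirY)
open Literature.MathematicalPhysics.QuantumFieldTheory.Balaban1983to89.Node00.OpsYCubeKnitPar (parKnitCubeY parKnitCubeY_one)
open scoped Matrix

variable {d ℓ : ℕ} {hd : 1 ≤ d + 1} {hL : Odd (ℓ + 1) ∧ 1 < ℓ + 1} {b₀ b₁ : ℝ}

/-! ## §1  ★★★ The four (3.42) entries of `G′_□(Uᵘ)` with the derivatives at `Uᵘ`, over the cube sequence's blocks -/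

section Main

open scoped Matrix.Norms.L2Operator

variable {N : ℕ} [Nonempty (Fin N)]
variable {ι : Type} [Fintype ι] [DecidableEq ι] (b : Module.Basis ι ℝ (Matrix (Fin N) (Fin N) ℂ))

set_option maxHeartbeats 1600000 in
/-- ★★★ **COROLLARY 3.6 AT ONE COVER CUBE ON ROAD P4 — THE FOUR (3.42) ENTRIES OF PRINT's DIRICHLET LETTER `G′_□(Uᵘ) = Ω₀(padΔ_{□,Ω₀}(Uᵘ))⁻¹Ω₀` AT THE CUBE-LEVEL
KNIT LEGS, WITH THE DERIVATIVES `∇_{Uᵘ,μ}`, `∇*_{Uᵘ,μ}`, `Δ_{Uᵘ}` OF THE WHOLE TORUS, OVER THE CUBE SEQUENCE's BLOCKS**, uniformly in the member and the cube: there are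
`δ > 0`, `B_f ≥ 0`, thresholds `M₀, T₀, N₀` and Theorem 3.4's `a₁ > 0` (functions of `d, L`, the basis datum `M₂, Σ‖b_j‖`) such that for every member above the thresholds,
every cover cube `□`, all letters `Rr, H`, every (3.35) datum `(u, A)` on a V1 set `Q ⊇ chart⁻¹Ω₀(□)` with `Uᵘ = e^{iηA}` on the bonds of `Q`, `‖A‖ ≤ Cξ⁻¹`, `‖η⁻¹∂A‖ ≤ Cξ⁻²`,
`η ≤ ξ`, `L^{n+1}η ≤ Λξ`, the collar geometry `hS2`, `α₁ := 2CΛ² ≤ min(a₁, ¼)`, p06's window numerics, and BI-CONTRACTIVE rotations `R(Uᵘ_μ(z))^{±1}` (G-valued fields):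
`padΔ_{□,Ω₀}(Uᵘ)` is a unit at `parKnitCubeY` and, with `O := G′_□(Uᵘ)`, `∇_μ := conj b(diffLetter Uᵘ η⁻¹ (inl μ))`, `−∇*_μ := conj b(diffLetter Uᵘ η⁻¹ (inr μ))`,
`L := conj b(η⁻²Δ_{Uᵘ})`: `conj b(η²O) ≺ B_f(Lⁿη)²e^{−δd}`, `∇_μ·conj b(η²O) ≺ B_fLⁿηe^{−δd}`, `conj b(η²O)·(−∇*_μ) ≺ B_fLⁿηe^{−δd}`, `L·conj b(η²O) ≺ B_f·1·e^{−δd}` — print's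
(3.42) for `G′_□(Uᵘ)` in [4]'s block-majorant form (Cor. 3.6 = Cor. 3.5 at `Uᵘ`; the passage to `U` by gauge invariance is the member-side reading).
[cite: Balaban1985BackgroundPropagators, Cor. 3.6 p.408 l.1–14, Thm 3.1 (3.42) p.397, Thm 3.4 p.400, p.394 l.24–33, p.403 l.1–9, (3.23)–(3.25) p.394, p.408–409; Balaban1984PropagatorsII, (2.51)–(2.55) p.232, Lemma 2.1 p.234] -/
theorem gpDir_cube_entries_at_field (d ℓ : ℕ) (hℓ : 1 ≤ ℓ) (M₂ : ℝ) (hM₂ : 0 ≤ M₂) (hrepr : ∀ (v : Matrix (Fin N) (Fin N) ℂ) (j : ι), |b.repr v j| ≤ M₂ * ‖v‖) :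
    ∃ δ Bf M₀ T₀ : ℝ, ∃ N₀ : ℕ, 0 < δ ∧ 0 ≤ Bf ∧ ∃ a₁ : ℝ, 0 < a₁ ∧
    ∀ {hd : 1 ≤ d + 1} {hL : Odd (ℓ + 1) ∧ 1 < ℓ + 1} {b₀ b₁ : ℝ} (i : KIdx d ℓ hd hL b₀ b₁) (c : ↥(cubes (toKT i).D.toDomains)) (Rr : ℝ) (H : Prop),
      M₀ ≤ ((ℓ : ℝ) + 1) * (toKT i).Mh → N₀ + 1 ≤ (toKT i).R * ((ℓ + 1) * (toKT i).Mh) → T₀ ≤ RM1 i →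
    ∀ (g : GaugeY (Matrix (Fin N) (Fin N) ℂ) i) (U : CfgY (Matrix (Fin N) (Fin N) ℂ) i) (A : AfldY (Matrix (Fin N) (Fin N) ℂ) i)
      (Q : Set (Site (PV d ℓ i.m i.K hd hL) 0)) (C ξ Λ α₀' : ℝ),
      0 ≤ C → (kGeo i).eta ≤ ξ → 1 ≤ Λ → LatticeNorms.scaleLen ((ℓ : ℝ) + 1) (kGeo i).eta (c.1.1 + 1) ≤ Λ * ξ →
      (∀ z ∈ dirDomY i c, (boxEquiv i.hN).symm z ∈ Q) →
      (∀ (κ : Fin (d + 1)) (x : Site (PV d ℓ i.m i.K hd hL) 0), x ∈ Q → x.shift κ ∈ Q → gaugeY i g U κ x = fluct (kGeo i).eta A κ x) →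
      (∀ κ, ∀ x ∈ Q, ‖A κ x‖ ≤ C * ξ⁻¹) →
      (∀ μ ν, ∀ x ∈ Q, ‖(((kGeo i).eta : ℂ)⁻¹) • covD (shiftsV1 (PV d ℓ i.m i.K hd hL)) (fun _ _ => (1 : (Matrix (Fin N) (Fin N) ℂ)ˣ)) μ (A ν) x‖ ≤ C * (ξ ^ 2)⁻¹) →
      (∀ z : SiteY i, 1 ≤ levCubeY i c z → z ∈ dirDomY i c ∧ ∀ μ, shiftY i μ z ∈ dirDomY i c ∧ (shiftY i μ).symm z ∈ dirDomY i c ∧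
        ∀ ν, shiftY i ν (shiftY i μ z) ∈ dirDomY i c ∧ shiftY i ν ((shiftY i μ).symm z) ∈ dirDomY i c ∧ (shiftY i ν).symm ((shiftY i μ).symm z) ∈ dirDomY i c) →
      2 * C * Λ ^ 2 ≤ a₁ → 2 * C * Λ ^ 2 ≤ 1 / 4 →
      0 < α₀' → C0 (d + 1) * α₀' ≤ 1 / 3 → 4 * α₀' ≤ c2' (d + 1) (ℓ + 1) →
      Real.exp (4 * (800 * (((d + 1 : ℕ) : ℝ) + 1) ^ 2 * (((d + 1 : ℕ) : ℝ) + 4)) * α₀') * (1 + 8 * (131072 * (((d + 1 : ℕ) : ℝ) + 1) ^ 2) * (2 * C * Λ ^ 2)) ≤ 2 →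
      2 * (2 * C * Λ ^ 2) ≤ c3 (d + 1) (ℓ + 1) → 4096 * ((d + 1 : ℕ) : ℝ) * (2 * C * Λ ^ 2) ≤ 1 →
      (∀ (μ : Fin (d + 1)) (z : SiteY i) (a : Matrix (Fin N) (Fin N) ℂ),
        ‖R (UboxY i (gaugeY i g U) μ z) a‖ ≤ ‖a‖ ∧ ‖R (UboxY i (gaugeY i g U) μ z)⁻¹ a‖ ≤ ‖a‖) →
      IsUnit (padDeltaCubeY i c (parKnitCubeY i c) (dirDomY i c) (gaugeY i g U)) ∧
      HasMajorant (g := toB6 (geoCK i c) Rr H) (fun p : SiteY i × ι => blkCubeY i c p.1)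
        (conj b (((kGeo i).eta ^ 2) • (GpDirY i c (parKnitCubeY i c) (dirDomY i c) (gaugeY i g U)).restrictScalars ℝ))
        (fun a a' => Bf * (geoCK i c).len a ^ 2 * Real.exp (-(δ * (geoCK i c).dist a a'))) ∧
      (∀ μ : Fin (d + 1), HasMajorant (g := toB6 (geoCK i c) Rr H) (fun p : SiteY i × ι => blkCubeY i c p.1)
        (conj b (diffLetter (shiftY i) (UboxY i (gaugeY i g U)) ((((kGeo i).eta : ℂ))⁻¹) (Sum.inl μ)) *
          conj b (((kGeo i).eta ^ 2) • (GpDirY i c (parKnitCubeY i c) (dirDomY i c) (gaugeY i g U)).restrictScalars ℝ))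
        (fun a a' => Bf * (geoCK i c).len a * Real.exp (-(δ * (geoCK i c).dist a a')))) ∧
      (∀ μ : Fin (d + 1), HasMajorant (g := toB6 (geoCK i c) Rr H) (fun p : SiteY i × ι => blkCubeY i c p.1)
        (conj b (((kGeo i).eta ^ 2) • (GpDirY i c (parKnitCubeY i c) (dirDomY i c) (gaugeY i g U)).restrictScalars ℝ) *
          conj b (diffLetter (shiftY i) (UboxY i (gaugeY i g U)) ((((kGeo i).eta : ℂ))⁻¹) (Sum.inr μ)))
        (fun a a' => Bf * (geoCK i c).len a * Real.exp (-(δ * (geoCK i c).dist a a')))) ∧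
      HasMajorant (g := toB6 (geoCK i c) Rr H) (fun p : SiteY i × ι => blkCubeY i c p.1)
        (conj b ((((kGeo i).eta ^ 2)⁻¹ : ℝ) • (lapSL i (gaugeY i g U)).restrictScalars ℝ) *
          conj b (((kGeo i).eta ^ 2) • (GpDirY i c (parKnitCubeY i c) (dirDomY i c) (gaugeY i g U)).restrictScalars ℝ))
        (fun a a' => Bf * 1 * Real.exp (-(δ * (geoCK i c).dist a a'))) := by
  letI : CStarAlgebra (Matrix (Fin N) (Fin N) ℂ) := {}
  have h1A : ‖(1 : Matrix (Fin N) (Fin N) ℂ)‖ ≤ 1 := norm_one.le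
  have hSb : 0 ≤ ∑ j, ‖b j‖ := Finset.sum_nonneg fun _ _ => norm_nonneg _
  set mb : ℝ := M₂ * ∑ j, ‖b j‖ with hmbdef
  have hmb : 0 ≤ mb := mul_nonneg hM₂ hSb
  obtain ⟨δ₀, BG, M₀, T₀, N₀, hδ₀, hBG, a₁, ha₁, B, hB, Hm⟩ := gpDir_cube_at_field b d ℓ hℓ M₂ hM₂ hrepr
  -- the rates: transferred entries at `δ′ = (9/10)δ₀`, shift corrections at `ρ′ = (1 − 1/20)ρ`, `ρ = (1 − 1/20)δ′`; final `δ_f = (4/5)δ₀`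
  set δ' : ℝ := 9 / 10 * δ₀ with hδ'def
  set ρ : ℝ := (1 - 1 / 20) * (9 / 10 * δ₀) with hρdef
  have hδ' : 0 < δ' := by rw [hδ'def]; positivity
  have hρ : 0 < ρ := by rw [hρdef]; positivity
  obtain ⟨dB, h261⟩ := exists_h261_geoCK d ℓ hρ
  set cB : ℝ := B6.c1 dB ρ (1 / 20) with hcBdef
  have hcB : 0 ≤ cB := c1_nonneg _ _ _
  set Λ4 : ℝ := ((ℓ : ℝ) + 1) ^ 4 with hΛ4def
  have hΛ4 : 0 ≤ Λ4 := by positivity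
  -- the constants
  set K₁ : ℝ := B + mb with hK₁def                                                     -- entry (1)
  set K₂ : ℝ := 2 * mb * (Real.exp δ' * B * Λ4 * cB ^ 2) with hK₂def                     -- left defect correction
  set K₃ : ℝ := B * (2 * mb) * Λ4 * Real.exp ρ * cB ^ 2 with hK₃def                      -- right defect correction
  set K₅ : ℝ := mb * mb * Real.exp δ' + mb with hK₅def                                  -- boundary words of (2), (3)
  set K₄ : ℝ := mb + mb * ((1 + CqK d * (1 / 4)) ^ 2 * mb) * K₁ with hK₄def               -- `Ω₀` and the averaging word of (4)
  set K₆ : ℝ := mb * mb * (Real.exp δ' * K₁ * Λ4 * cB ^ 2) with hK₆def                   -- one flux word of (4)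
  have hK₁ : 0 ≤ K₁ := by rw [hK₁def]; positivity
  have hK₂ : 0 ≤ K₂ := by rw [hK₂def]; positivity
  have hK₃ : 0 ≤ K₃ := by rw [hK₃def]; positivity
  have hK₅ : 0 ≤ K₅ := by rw [hK₅def]; positivity
  have hK₄ : 0 ≤ K₄ := by rw [hK₄def]; have := CqK_nonneg d; positivity
  have hK₆ : 0 ≤ K₆ := by rw [hK₆def]; positivity
  set Bf : ℝ := B + K₁ + K₂ + K₃ + K₅ + K₄ + (((d : ℝ) + 1) * (K₆ + K₆)) with hBfdef
  have hBf : 0 ≤ Bf := by rw [hBfdef]; positivity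
  refine ⟨4 / 5 * δ₀, Bf, M₀, T₀, max N₀ (N1 d ℓ (9 / 5000 * ρ)), by positivity, hBf, a₁, ha₁, ?_⟩
  intro hd hL b₀ b₁ i c Rr H hM hN hT g U A Q C ξ Λ α₀' hC hξ hΛ hΛξ hQ hgA hA hdA hS2 hα₁ hα4 hα' hα3 hα4' hsmall hc₃ hsm hR
  have hN₀ : N₀ + 1 ≤ (toKT i).R * ((ℓ + 1) * (toKT i).Mh) := le_trans (Nat.succ_le_succ (le_max_left _ _)) hN
  have hNρ : N1 d ℓ (9 / 5000 * ρ) + 1 ≤ (toKT i).R * ((ℓ + 1) * (toKT i).Mh) := le_trans (Nat.succ_le_succ (le_max_right _ _)) hN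
  obtain ⟨⟨⟨hunit, -⟩, hpad, hunitV, -⟩, ⟨hT1, -⟩, ⟨hbase, hL0, hR0⟩, ⟨r4, r5, hkF, hsF⟩, HX, HY⟩ :=
    Hm i c Rr H hM hN₀ hT g U A Q C ξ Λ α₀' hC hξ hΛ hΛξ hQ hgA hA hdA hS2 hα₁ hα4 hα' hα3 hα4' hsmall hc₃ hsm
  set α₁ : ℝ := 2 * C * Λ ^ 2 with hα₁def
  have hα₁0 : 0 ≤ α₁ := by rw [hα₁def]; positivity
  have hα14 : α₁ ≤ 1 / 4 := hα4
  set η : ℝ := (kGeo i).eta with hηdef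
  have hη : 0 < η := by rw [hηdef, ← geoCK_eta i c]; exact geoCK_eta_pos i c
  have hη0 : η ≠ 0 := hη.ne'
  set S := dirDomY i c with hSdef
  set V := gaugeY i g U with hVdef
  set Vt := cutCfgS i S η A with hVtdef
  set par := parKnitCubeY (𝔸 := Matrix (Fin N) (Fin N) ℂ) i c with hpardef
  set G := GpDirVK b i c par A with hGdef
  set O := GpDirY i c par S V with hOdef
  haveI : Nonempty (geoCK i c).Site := geoCK_site_nonempty i c
  obtain ⟨hdnn, htri, hrefl, hsym⟩ := geoCK_dist_axioms i c Rr H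
  have hlen0 : ∀ a : BlkCubeY i c, 0 ≤ (geoCK i c).len a := fun a => (geoCK_len_pos i c a).le
  have hpow2 : ∀ a : BlkCubeY i c, 0 ≤ (geoCK i c).len a ^ 2 := fun a => sq_nonneg _
  have hlenη : ∀ a : BlkCubeY i c, η ≤ (geoCK i c).len a := fun a => by rw [hηdef, ← geoCK_eta i c]; exact geoCK_eta_le_len i c a
  have hlenη2 : ∀ a : BlkCubeY i c, η ^ 2 ≤ (geoCK i c).len a ^ 2 := fun a => pow_le_pow_left₀ hη.le (hlenη a) 2
  -- the geometry: `Ω₀(□) ⊇ {lev_□ ≥ 1}` and its consequences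
  have hS1 : ∀ z : SiteY i, 1 ≤ levCubeY i c z → z ∈ S := fun z hz => (hS2 z hz).1
  have hS0 : ∀ z : SiteY i, z ∉ S → levCubeY i c z = 0 := fun z hz => by
    by_contra hne
    exact hz (hS1 z (Nat.one_le_iff_ne_zero.2 hne))
  -- the padded inverse at `Uᵘ` IS `G`
  have hGV : conj b ((η ^ 2) • (GinvY i c par S V).restrictScalars ℝ) = G := by
    rw [hGdef, GpDirVK]
    unfold GinvY
    rw [hSdef, hVdef, ← hpad]
  -- (0) `G ≺ B·len²·e^{−δ′d}`
  have hG : HasMajorant (g := toB6 (geoCK i c) Rr H) (fun p : SiteY i × ι => blkCubeY i c p.1) G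
      (fun a a' => B * (geoCK i c).len a ^ 2 * Real.exp (-(δ' * (geoCK i c).dist a a'))) :=
    hasMajorant_GpDirVK b i c par Rr H A hbase HX
  -- the base-derived derivative entries at `δ′`
  have hL1 : ∀ k, HasMajorant (g := toB6 (geoCK i c) Rr H) (fun p : SiteY i × ι => blkCubeY i c p.1)
      (conj b (diffLetter (shiftY i) (fun _ _ => (1 : (Matrix (Fin N) (Fin N) ℂ)ˣ)) (((η : ℂ))⁻¹) k) * G)
      (fun a a' => B * (geoCK i c).len a * Real.exp (-(δ' * (geoCK i c).dist a a'))) :=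
    fun k => HX _ (fun a => (geoCK i c).len a) hlen0 (by rw [hηdef, ← geoCK_eta i c]; exact hL0 k)
  have hR1 : ∀ k, HasMajorant (g := toB6 (geoCK i c) Rr H) (fun p : SiteY i × ι => blkCubeY i c p.1)
      (G * conj b (diffLetter (shiftY i) (fun _ _ => (1 : (Matrix (Fin N) (Fin N) ℂ)ˣ)) (((η : ℂ))⁻¹) k))
      (fun a a' => B * (geoCK i c).len a * Real.exp (-(δ' * (geoCK i c).dist a a'))) :=
    fun k => HY _ (by rw [hηdef, ← geoCK_eta i c]; exact hR0 k)
  -- the scale transfers at `δ′` with exponent `1/20`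
  have hconv : ∀ t : ℝ, -(1 / 20 * (9 / 10 * δ₀) * t) = -(9 / 200 * δ₀ * t) := fun t => by ring
  obtain ⟨-, hST2, hST3, -, -, -⟩ := hST_geoCK i c hδ₀ hT1 (9 / 200) (by norm_num)
  have hPΛ : ∀ a e : BlkCubeY i c, Real.exp (-(1 / 20 * δ' * (geoCK i c).dist a e)) * (geoCK i c).len e ^ 2 ≤ Λ4 * (geoCK i c).len a ^ 2 :=
    fun a e => by rw [hδ'def, hconv]; exact hST2 a e
  have hPΛ' : ∀ a e : BlkCubeY i c, Real.exp (-(1 / 20 * δ' * (geoCK i c).dist a e)) * ((geoCK i c).len e)⁻¹ ≤ Λ4 * ((geoCK i c).len a)⁻¹ :=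
    fun a e => by rw [hδ'def, hconv]; exact hST3 a e
  have h261ρ : Ineq261 dB (toB6 (geoCK i c) Rr H) ((1 - 1 / 20) * δ') (1 / 20) := h261 i c Rr H hNρ (1 / 20) (by norm_num) (by norm_num)
  have hαδ : 0 ≤ 1 / 20 * δ' := by positivity
  have hρ' : 0 ≤ (1 - 1 / 20) * δ' := by rw [hδ'def]; positivity
  have eρ : (1 - 1 / 20) * δ' = ρ := by rw [hρdef, hδ'def]
  -- ROW-LOCAL LETTERS
  -- the defect multipliers of `Uᵘ` (UNIT 8a §3): coefficient `2(Lⁿη)⁻¹`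
  have hVin : ∀ (μ : Fin (d + 1)) (z : SiteY i), z ∈ S → shiftY i μ z ∈ S → UboxY i V μ z = fluct (kGeo i).eta A μ ((boxEquiv i.hN).symm z) :=
    fun μ z hz hz' => by rw [hVdef, ← UboxY_cutCfgS_of_mem i hQ hgA hz hz', UboxY_cutCfgS, if_pos ⟨hz, hz'⟩]
  have hAin : ∀ (μ : Fin (d + 1)) (z : SiteY i), z ∈ S → shiftY i μ z ∈ S → ‖A μ ((boxEquiv i.hN).symm z)‖ ≤ α₁ * ((geoCK i c).len (blkCubeY i c z))⁻¹ :=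
    fun μ z hz hz' => by
      have h := r4 μ z
      rwa [chartA_cutFldS, (cutAc_apply_of i S (chartA i A) μ z).1 ⟨hz, hz'⟩, chartA_apply] at h
  have hAinB : ∀ (μ : Fin (d + 1)) (z : SiteY i), (shiftY i μ).symm z ∈ S → z ∈ S →
      ‖A μ ((boxEquiv i.hN).symm ((shiftY i μ).symm z))‖ ≤ α₁ * ((geoCK i c).len (blkCubeY i c z))⁻¹ := fun μ z hz hz' => by
    have h := r5 μ μ z
    have hb : (shiftY i μ).symm z ∈ S ∧ shiftY i μ ((shiftY i μ).symm z) ∈ S := ⟨hz, by rw [Equiv.apply_symm_apply]; exact hz'⟩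
    rwa [tauB_one_apply, chartA_cutFldS, (cutAc_apply_of i S (chartA i A) μ _).1 hb, chartA_apply] at h
  have hcF : ∀ a : BlkCubeY i c, 0 ≤ 2 * ((geoCK i c).len a)⁻¹ := fun a => mul_nonneg zero_le_two (inv_nonneg.2 (hlen0 a))
  have hlocF : ∀ μ, ∀ (w : SiteY i × ι → ℝ) (p : SiteY i × ι) (Mb : ℝ), (∀ p' : SiteY i × ι, blkCubeY i c p'.1 = blkCubeY i c p.1 → |w p'| ≤ Mb) →
      |conj b (mulDefF i V (((η : ℂ))⁻¹) μ) w p| ≤ 2 * ((geoCK i c).len (blkCubeY i c p.1))⁻¹ * mb * Mb :=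
    fun μ => rowLocal_conj_of_local b (blkCubeY i c) (fun a => 2 * ((geoCK i c).len a)⁻¹) hM₂ hrepr _ fun f x Bf' hBf' =>
      (norm_mulDefF_apply_le_two i c hα₁0 hα14 (fun z hz => ⟨(hS2 z hz).1, ((hS2 z hz).2 μ).1⟩) (hVin μ) (hAin μ) (fun z a => (hR μ z a).1) f x).trans
        (mul_le_mul_of_nonneg_left (hBf' x rfl) (hcF _))
  have hlocB : ∀ μ, ∀ (w : SiteY i × ι → ℝ) (p : SiteY i × ι) (Mb : ℝ), (∀ p' : SiteY i × ι, blkCubeY i c p'.1 = blkCubeY i c p.1 → |w p'| ≤ Mb) →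
      |conj b (mulDefB i V (((η : ℂ))⁻¹) μ) w p| ≤ 2 * ((geoCK i c).len (blkCubeY i c p.1))⁻¹ * mb * Mb :=
    fun μ => rowLocal_conj_of_local b (blkCubeY i c) (fun a => 2 * ((geoCK i c).len a)⁻¹) hM₂ hrepr _ fun f x Bf' hBf' =>
      (norm_mulDefB_apply_le_two i c hα₁0 hα14 (fun z hz => ⟨((hS2 z hz).2 μ).2.1, (hS2 z hz).1⟩) (hVin μ) (hAinB μ) (fun z a => (hR μ z a).2) f x).trans
        (mul_le_mul_of_nonneg_left (hBf' x rfl) (hcF _))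
  -- the exterior indicator `r(1 − Ω₀)`: coefficient `|r|`
  have hlocE : ∀ r : ℝ, ∀ (w : SiteY i × ι → ℝ) (p : SiteY i × ι) (Mb : ℝ), (∀ p' : SiteY i × ι, blkCubeY i c p'.1 = blkCubeY i c p.1 → |w p'| ≤ Mb) →
      |conj b (exMul i S r) w p| ≤ |r| * mb * Mb :=
    fun r => rowLocal_conj_of_local b (blkCubeY i c) (fun _ => |r|) hM₂ hrepr _ fun f x Bf' hBf' =>
      (norm_exMul_apply_le' i r f x).trans (mul_le_mul_of_nonneg_left (hBf' x rfl) (abs_nonneg r))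
  -- `η⁻²(1 − Ω₀)`: coefficient `(Lⁿη)⁻²` (rows off `Ω₀` have level `0`)
  have hlocE2 : ∀ (w : SiteY i × ι → ℝ) (p : SiteY i × ι) (Mb : ℝ), (∀ p' : SiteY i × ι, blkCubeY i c p'.1 = blkCubeY i c p.1 → |w p'| ≤ Mb) →
      |conj b (exMul i S ((η ^ 2)⁻¹)) w p| ≤ ((geoCK i c).len (blkCubeY i c p.1) ^ 2)⁻¹ * mb * Mb :=
    rowLocal_conj_of_local b (blkCubeY i c) (fun a => ((geoCK i c).len a ^ 2)⁻¹) hM₂ hrepr _ fun f x Bf' hBf' => by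
      rw [exMul_apply]
      split_ifs with hx
      · rw [norm_zero]; exact mul_nonneg (inv_nonneg.2 (sq_nonneg _)) ((norm_nonneg _).trans (hBf' x rfl))
      · have hlen : (geoCK i c).len (blkCubeY i c x) = η := by rw [(geoCK_len_blkCubeY i c x).1, hS0 x hx, pow_zero, one_mul]
        rw [norm_smul, Real.norm_eq_abs, abs_of_pos (inv_pos.2 (pow_pos hη 2)), hlen]
        exact mul_le_mul_of_nonneg_left (hBf' x rfl) (inv_nonneg.2 (sq_nonneg _))
  -- the rotations: coefficient `|r|`
  have hlocRF : ∀ (r : ℝ) (μ : Fin (d + 1)), ∀ (w : SiteY i × ι → ℝ) (p : SiteY i × ι) (Mb : ℝ),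
      (∀ p' : SiteY i × ι, blkCubeY i c p'.1 = blkCubeY i c p.1 → |w p'| ≤ Mb) → |conj b (rotF i V r μ) w p| ≤ |r| * mb * Mb :=
    fun r μ => rowLocal_conj_of_local b (blkCubeY i c) (fun _ => |r|) hM₂ hrepr _ fun f x Bf' hBf' =>
      (norm_rotF_apply_le i (fun a => (hR μ x a).1) r f).trans (mul_le_mul_of_nonneg_left (hBf' x rfl) (abs_nonneg r))
  have hlocRB : ∀ (r : ℝ) (μ : Fin (d + 1)), ∀ (w : SiteY i × ι → ℝ) (p : SiteY i × ι) (Mb : ℝ),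
      (∀ p' : SiteY i × ι, blkCubeY i c p'.1 = blkCubeY i c p.1 → |w p'| ≤ Mb) → |conj b (rotB i V r μ) w p| ≤ |r| * mb * Mb :=
    fun r μ => rowLocal_conj_of_local b (blkCubeY i c) (fun _ => |r|) hM₂ hrepr _ fun f x Bf' hBf' =>
      (norm_rotB_apply_le i (fun a => (hR μ _ a).2) r f).trans (mul_le_mul_of_nonneg_left (hBf' x rfl) (abs_nonneg r))
  -- `Ω₀`: coefficient `1`
  have hlocP : ∀ (w : SiteY i × ι → ℝ) (p : SiteY i × ι) (Mb : ℝ), (∀ p' : SiteY i × ι, blkCubeY i c p'.1 = blkCubeY i c p.1 → |w p'| ≤ Mb) →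
      |conj b ((cubeProjY i S).restrictScalars ℝ) w p| ≤ 1 * mb * Mb :=
    rowLocal_conj_of_local b (blkCubeY i c) (fun _ => (1 : ℝ)) hM₂ hrepr _ fun f x Bf' hBf' => by
      rw [LinearMap.restrictScalars_apply, cubeProjY_apply, one_mul]
      split_ifs
      · exact hBf' x rfl
      · rw [norm_zero]; exact (norm_nonneg _).trans (hBf' x rfl)
  -- the averaging operator `η⁻²avg(Uᵘ) = η⁻²avg(Ṽ)`: coefficient `(1 + C_q^Kα₁)²(Lⁿη)⁻²`
  have hparone : ∀ z w : SiteY i, par (fun _ _ => (1 : (Matrix (Fin N) (Fin N) ℂ)ˣ)) z w = 1 := fun z w => parKnitCubeY_one i c z w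
  have havg : avgOpY i c par V = avgOpY i c par Vt := by rw [hVdef, hVtdef, hpardef, avgOpY_cutCfgS_eq_gaugeY i c hS1 hQ hgA]
  have hlocAvg : ∀ (w : SiteY i × ι → ℝ) (p : SiteY i × ι) (Mb : ℝ), (∀ p' : SiteY i × ι, blkCubeY i c p'.1 = blkCubeY i c p.1 → |w p'| ≤ Mb) →
      |conj b ((((η ^ 2)⁻¹ : ℝ)) • (avgOpY i c par V).restrictScalars ℝ) w p| ≤
        (1 + CqK d * α₁) ^ 2 * ((geoCK i c).len (blkCubeY i c p.1) ^ 2)⁻¹ * mb * Mb := by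
    rw [havg]
    exact rowLocal_conj_of_local b (blkCubeY i c) (fun a => (1 + CqK d * α₁) ^ 2 * ((geoCK i c).len a ^ 2)⁻¹) hM₂ hrepr _ fun f x Bf' hBf' =>
      norm_avgCube_apply_le i c par h1A hparone Vt (CqK_nonneg d) hα₁0 hkF hsF f x Bf' hBf'
  -- SHIFTS: `conj b(σ_{±μ}) ≺ e^{δ′}e^{−δ′d}`, and after `G` ∕ after `conj b(η²O)` with the scale transfer
  have hσ : ∀ μ, HasMajorant (g := toB6 (geoCK i c) Rr H) (fun p : SiteY i × ι => blkCubeY i c p.1)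
      (conj b ((shiftOpY (𝔸 := Matrix (Fin N) (Fin N) ℂ) i μ).restrictScalars ℝ)) (fun a a' => Real.exp δ' * Real.exp (-(δ' * (geoCK i c).dist a a'))) :=
    fun μ => hasMajorant_conj_shiftOpY i c b Rr H hδ'.le μ
  have hσ' : ∀ μ, HasMajorant (g := toB6 (geoCK i c) Rr H) (fun p : SiteY i × ι => blkCubeY i c p.1)
      (conj b ((shiftOpY' (𝔸 := Matrix (Fin N) (Fin N) ℂ) i μ).restrictScalars ℝ)) (fun a a' => Real.exp δ' * Real.exp (-(δ' * (geoCK i c).dist a a'))) :=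
    fun μ => hasMajorant_conj_shiftOpY' i c b Rr H hδ'.le μ
  have hshiftG : ∀ μ, HasMajorant (g := toB6 (geoCK i c) Rr H) (fun p : SiteY i × ι => blkCubeY i c p.1)
      (conj b ((shiftOpY (𝔸 := Matrix (Fin N) (Fin N) ℂ) i μ).restrictScalars ℝ) * G)
      (fun a a' => Real.exp δ' * B * Λ4 * cB ^ 2 * (geoCK i c).len a ^ 2 * Real.exp (-((1 - 1 / 20) * ((1 - 1 / 20) * δ') * (geoCK i c).dist a a'))) :=
    fun μ => hasMajorant_shift_mul_weighted i c Rr H (fun p : SiteY i × ι => blkCubeY i c p.1) dB (fun a => (geoCK i c).len a ^ 2)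
      (Real.exp_nonneg _) hB hΛ4 hpow2 hαδ hρ' (by norm_num) htri hPΛ h261ρ (hσ μ) hG
  -- a helper: sums of same-shape majorants, weakening to the final rate
  have hrate1 : 4 / 5 * δ₀ ≤ δ' := by rw [hδ'def]; linarith
  have hrate2 : 4 / 5 * δ₀ ≤ (1 - 1 / 20) * ((1 - 1 / 20) * δ') := by rw [hδ'def]; linarith
  have hrateρ2 : (1 - 1 / 20) * ((1 - 1 / 20) * δ') ≤ δ' := by rw [hδ'def]; linarith
  have hexpρ2 : ∀ a a' : BlkCubeY i c, Real.exp (-(δ' * (geoCK i c).dist a a')) ≤ Real.exp (-((1 - 1 / 20) * ((1 - 1 / 20) * δ') * (geoCK i c).dist a a')) :=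
    fun a a' => Real.exp_le_exp.2 (by have h := mul_le_mul_of_nonneg_right hrateρ2 (hdnn a a'); linarith)
  have hηabs : |η| = η := abs_of_pos hη
  -- the exterior indicator alone: `conj b(r(1 − Ω₀)) ≺ |r|·mb·e^{−δ′d}`
  have hE : ∀ r : ℝ, HasMajorant (g := toB6 (geoCK i c) Rr H) (fun p : SiteY i × ι => blkCubeY i c p.1) (conj b (exMul i S r))
      (fun a a' => |r| * mb * Real.exp (-(δ' * (geoCK i c).dist a a'))) := fun r => by
    have h := hasMajorant_mul_of_rowLocal (g := toB6 (geoCK i c) Rr H) (fun p : SiteY i × ι => blkCubeY i c p.1) (fun _ => |r| * mb) (hlocE r)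
      (hasMajorant_one_decay i c Rr H (fun p : SiteY i × ι => blkCubeY i c p.1) δ')
    rwa [mul_one] at h
  ----------------------------------------------------------------
  -- (1) `conj b(η²O) = G − conj b(η²(1 − Ω₀)) ≺ K₁·len²·e^{−δ′d}`
  ----------------------------------------------------------------
  have hO : HasMajorant (g := toB6 (geoCK i c) Rr H) (fun p : SiteY i × ι => blkCubeY i c p.1) (conj b ((η ^ 2) • O.restrictScalars ℝ))
      (fun a a' => K₁ * (geoCK i c).len a ^ 2 * Real.exp (-(δ' * (geoCK i c).dist a a'))) := by
    rw [hOdef, conj_O_eq b i c par hunitV η, hGV, sub_eq_add_neg]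
    refine hasMajorant_mono (g := toB6 (geoCK i c) Rr H) _ (hasMajorant_add (g := toB6 (geoCK i c) Rr H) _ hG
      (B9Cor35GpCubeInputsAtOne.hasMajorant_neg (g := toB6 (geoCK i c) Rr H) _ (hE (η ^ 2)))) fun a a' => ?_
    rw [abs_of_nonneg (sq_nonneg η), hK₁def]
    have hx : 0 ≤ mb * Real.exp (-(δ' * (geoCK i c).dist a a')) := mul_nonneg hmb (Real.exp_nonneg _)
    have h2 := mul_le_mul_of_nonneg_right (hlenη2 a) hx
    linarith
  ----------------------------------------------------------------
  -- (2) LEFT DERIVATIVE: `conj b(∇_{Uᵘ,μ})·conj b(η²O) = conj b(∇_{Uᵘ,μ})·G − conj b(ηR)·conj b(σ)·conj b(1 − Ω₀) + conj b(η(1 − Ω₀))`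
  ----------------------------------------------------------------
  -- (2a) `conj b(∇_{Uᵘ,μ})·G = conj b(∇_{1,μ})·G + conj b(mulDefF)·(conj b(σ)·G) ≺ (B + K₂)·len·e^{−ρ″d}`
  have hVG : ∀ μ, HasMajorant (g := toB6 (geoCK i c) Rr H) (fun p : SiteY i × ι => blkCubeY i c p.1)
      (conj b (diffLetter (shiftY i) (UboxY i V) (((η : ℂ))⁻¹) (Sum.inl μ)) * G)
      (fun a a' => (B + K₂) * (geoCK i c).len a * Real.exp (-((1 - 1 / 20) * ((1 - 1 / 20) * δ') * (geoCK i c).dist a a'))) := by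
    intro μ
    have e : conj b (diffLetter (shiftY i) (UboxY i V) (((η : ℂ))⁻¹) (Sum.inl μ)) * G =
        conj b (diffLetter (shiftY i) (fun _ _ => (1 : (Matrix (Fin N) (Fin N) ℂ)ˣ)) (((η : ℂ))⁻¹) (Sum.inl μ)) * G +
          conj b (mulDefF i V (((η : ℂ))⁻¹) μ) * (conj b ((shiftOpY (𝔸 := Matrix (Fin N) (Fin N) ℂ) i μ).restrictScalars ℝ) * G) := by
      rw [diffLetter_inl_eq_add, conj_add, add_mul, B9Eq352DivFormLetters.conj_mul, mul_assoc]
    rw [e]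
    refine hasMajorant_mono (g := toB6 (geoCK i c) Rr H) _ (hasMajorant_add (g := toB6 (geoCK i c) Rr H) _ (hL1 (Sum.inl μ))
      (hasMajorant_mul_of_rowLocal (g := toB6 (geoCK i c) Rr H) (fun p : SiteY i × ι => blkCubeY i c p.1)
        (fun a => 2 * ((geoCK i c).len a)⁻¹ * mb) (hlocF μ) (hshiftG μ))) fun a a' => ?_
    have hl := geoCK_len_pos i c a
    have e1 : ((geoCK i c).len a)⁻¹ * (geoCK i c).len a ^ 2 = (geoCK i c).len a := by field_simp
    have hsh : 2 * ((geoCK i c).len a)⁻¹ * mb * (Real.exp δ' * B * Λ4 * cB ^ 2 * (geoCK i c).len a ^ 2 *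
          Real.exp (-((1 - 1 / 20) * ((1 - 1 / 20) * δ') * (geoCK i c).dist a a'))) =
        K₂ * (geoCK i c).len a * Real.exp (-((1 - 1 / 20) * ((1 - 1 / 20) * δ') * (geoCK i c).dist a a')) := by
      rw [hK₂def]
      calc 2 * ((geoCK i c).len a)⁻¹ * mb * (Real.exp δ' * B * Λ4 * cB ^ 2 * (geoCK i c).len a ^ 2 *
            Real.exp (-((1 - 1 / 20) * ((1 - 1 / 20) * δ') * (geoCK i c).dist a a')))
          = 2 * mb * (Real.exp δ' * B * Λ4 * cB ^ 2) * (((geoCK i c).len a)⁻¹ * (geoCK i c).len a ^ 2) *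
            Real.exp (-((1 - 1 / 20) * ((1 - 1 / 20) * δ') * (geoCK i c).dist a a')) := by ring
        _ = _ := by rw [e1]
    rw [hsh]
    have hB1 : B * (geoCK i c).len a * Real.exp (-(δ' * (geoCK i c).dist a a')) ≤
        B * (geoCK i c).len a * Real.exp (-((1 - 1 / 20) * ((1 - 1 / 20) * δ') * (geoCK i c).dist a a')) :=
      mul_le_mul_of_nonneg_left (hexpρ2 a a') (mul_nonneg hB (hlen0 a))
    linarith [hB1]
  -- (2b) the boundary words of (2): `conj b(ηR(Uᵘ_μ))·conj b(σ_μ)·conj b(1 − Ω₀) ≺ mb²e^{δ′}·len·e^{−δ′d}`, `conj b(η(1 − Ω₀)) ≺ mb·len·e^{−δ′d}`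
  have hbdL : ∀ μ, HasMajorant (g := toB6 (geoCK i c) Rr H) (fun p : SiteY i × ι => blkCubeY i c p.1)
      (conj b (rotF i V η μ) * conj b ((shiftOpY (𝔸 := Matrix (Fin N) (Fin N) ℂ) i μ).restrictScalars ℝ) * conj b (exMul i S 1))
      (fun a a' => mb * mb * Real.exp δ' * (geoCK i c).len a * Real.exp (-(δ' * (geoCK i c).dist a a'))) := by
    intro μ
    refine hasMajorant_mono (g := toB6 (geoCK i c) Rr H) _
      (hasMajorant_mul_of_rowLocal_right (g := toB6 (geoCK i c) Rr H) (fun p : SiteY i × ι => blkCubeY i c p.1) (fun _ => |(1 : ℝ)| * mb)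
        (fun _ => mul_nonneg (abs_nonneg _) hmb) (hlocE 1)
        (hasMajorant_mul_of_rowLocal (g := toB6 (geoCK i c) Rr H) (fun p : SiteY i × ι => blkCubeY i c p.1) (fun _ => |η| * mb) (hlocRF η μ) (hσ μ)))
      fun a a' => ?_
    rw [hηabs, abs_one, one_mul]
    have hx : 0 ≤ mb * mb * Real.exp δ' * Real.exp (-(δ' * (geoCK i c).dist a a')) := by positivity
    calc η * mb * (Real.exp δ' * Real.exp (-(δ' * (geoCK i c).dist a a'))) * mb = η * (mb * mb * Real.exp δ' * Real.exp (-(δ' * (geoCK i c).dist a a'))) := by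
          ring
      _ ≤ (geoCK i c).len a * (mb * mb * Real.exp δ' * Real.exp (-(δ' * (geoCK i c).dist a a'))) := mul_le_mul_of_nonneg_right (hlenη a) hx
      _ = _ := by ring
  have hEη : HasMajorant (g := toB6 (geoCK i c) Rr H) (fun p : SiteY i × ι => blkCubeY i c p.1) (conj b (exMul i S η))
      (fun a a' => mb * (geoCK i c).len a * Real.exp (-(δ' * (geoCK i c).dist a a'))) := by
    refine hasMajorant_mono (g := toB6 (geoCK i c) Rr H) _ (hE η) fun a a' => ?_
    rw [hηabs]
    have hx : 0 ≤ mb * Real.exp (-(δ' * (geoCK i c).dist a a')) := by positivity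
    calc η * mb * Real.exp (-(δ' * (geoCK i c).dist a a')) = η * (mb * Real.exp (-(δ' * (geoCK i c).dist a a'))) := by ring
      _ ≤ (geoCK i c).len a * (mb * Real.exp (-(δ' * (geoCK i c).dist a a'))) := mul_le_mul_of_nonneg_right (hlenη a) hx
      _ = _ := by ring
  ----------------------------------------------------------------
  -- (3) RIGHT DERIVATIVE: `conj b(η²O)·conj b(−∇*_{Uᵘ,μ}) = G·conj b(−∇*) − conj b(η(1 − Ω₀)) + conj b(1 − Ω₀)·conj b(ηR⁻¹)·conj b(σ_{−μ})`
  ----------------------------------------------------------------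
  -- (3a) `G·conj b(−∇*_{Uᵘ,μ}) = G·conj b(−∇*_{1,μ}) − (G·conj b(mulDefB))·conj b(σ_{−μ}) ≺ (B + K₃)·len·e^{−ρ″d}`
  have hGVR : ∀ μ, HasMajorant (g := toB6 (geoCK i c) Rr H) (fun p : SiteY i × ι => blkCubeY i c p.1)
      (G * conj b (diffLetter (shiftY i) (UboxY i V) (((η : ℂ))⁻¹) (Sum.inr μ)))
      (fun a a' => (B + K₃) * (geoCK i c).len a * Real.exp (-((1 - 1 / 20) * ((1 - 1 / 20) * δ') * (geoCK i c).dist a a'))) := by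
    intro μ
    have hin : HasMajorant (g := toB6 (geoCK i c) Rr H) (fun p : SiteY i × ι => blkCubeY i c p.1) (G * conj b (mulDefB i V (((η : ℂ))⁻¹) μ))
        (fun a a' => B * (geoCK i c).len a ^ 2 * Real.exp (-(δ' * (geoCK i c).dist a a')) * (2 * mb * ((geoCK i c).len a')⁻¹)) :=
      hasMajorant_mono (g := toB6 (geoCK i c) Rr H) _
        (hasMajorant_mul_of_rowLocal_right (g := toB6 (geoCK i c) Rr H) (fun p : SiteY i × ι => blkCubeY i c p.1)
          (fun a => 2 * ((geoCK i c).len a)⁻¹ * mb) (fun a => mul_nonneg (hcF a) hmb) (hlocB μ) hG)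
        fun a a' => le_of_eq (by ring)
    have hout := hasMajorant_weighted_mul_shift i c Rr H (fun p : SiteY i × ι => blkCubeY i c p.1) dB (δ := δ') (α := 1 / 20) (α' := 1 / 20)
      (r := 2 * mb) (A := B) (Λ := Λ4) (by positivity) hB hΛ4 hρ' (by norm_num) htri hPΛ' h261ρ hin
      (hasMajorant_conj_shiftOpY' i c b Rr H hρ' μ)
    have e : G * conj b (diffLetter (shiftY i) (UboxY i V) (((η : ℂ))⁻¹) (Sum.inr μ)) =
        G * conj b (diffLetter (shiftY i) (fun _ _ => (1 : (Matrix (Fin N) (Fin N) ℂ)ˣ)) (((η : ℂ))⁻¹) (Sum.inr μ)) +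
          -(G * conj b (mulDefB i V (((η : ℂ))⁻¹) μ) * conj b ((shiftOpY' (𝔸 := Matrix (Fin N) (Fin N) ℂ) i μ).restrictScalars ℝ)) := by
      calc G * conj b (diffLetter (shiftY i) (UboxY i V) (((η : ℂ))⁻¹) (Sum.inr μ))
          = G * (conj b (diffLetter (shiftY i) (fun _ _ => (1 : (Matrix (Fin N) (Fin N) ℂ)ˣ)) (((η : ℂ))⁻¹) (Sum.inr μ)) -
              conj b (mulDefB i V (((η : ℂ))⁻¹) μ) * conj b ((shiftOpY' (𝔸 := Matrix (Fin N) (Fin N) ℂ) i μ).restrictScalars ℝ)) := by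
            rw [diffLetter_inr_eq_sub, conj_sub, B9Eq352DivFormLetters.conj_mul]
        _ = _ := by rw [mul_sub, sub_eq_add_neg, mul_assoc]
    rw [e]
    refine hasMajorant_mono (g := toB6 (geoCK i c) Rr H) _ (hasMajorant_add (g := toB6 (geoCK i c) Rr H) _ (hR1 (Sum.inr μ))
      (B9Cor35GpCubeInputsAtOne.hasMajorant_neg (g := toB6 (geoCK i c) Rr H) _ hout)) fun a a' => ?_
    have hB1 : B * (geoCK i c).len a * Real.exp (-(δ' * (geoCK i c).dist a a')) ≤
        B * (geoCK i c).len a * Real.exp (-((1 - 1 / 20) * ((1 - 1 / 20) * δ') * (geoCK i c).dist a a')) :=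
      mul_le_mul_of_nonneg_left (hexpρ2 a a') (mul_nonneg hB (hlen0 a))
    have e3 : B * (2 * mb) * Λ4 * Real.exp ((1 - 1 / 20) * δ') * B6.c1 dB ((1 - 1 / 20) * δ') (1 / 20) ^ 2 * (geoCK i c).len a *
          Real.exp (-((1 - 1 / 20) * ((1 - 1 / 20) * δ') * (geoCK i c).dist a a')) =
        K₃ * (geoCK i c).len a * Real.exp (-((1 - 1 / 20) * ((1 - 1 / 20) * δ') * (geoCK i c).dist a a')) := by
      rw [hK₃def, eρ, hcBdef]
    rw [e3]
    linarith [hB1]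
  -- (3b) the boundary word `conj b(1 − Ω₀)·conj b(ηR⁻¹)·conj b(σ_{−μ}) ≺ mb²e^{δ′}·len·e^{−δ′d}`
  have hbdR : ∀ μ, HasMajorant (g := toB6 (geoCK i c) Rr H) (fun p : SiteY i × ι => blkCubeY i c p.1)
      (conj b (exMul i S 1) * conj b (rotB i V η μ) * conj b ((shiftOpY' (𝔸 := Matrix (Fin N) (Fin N) ℂ) i μ).restrictScalars ℝ))
      (fun a a' => mb * mb * Real.exp δ' * (geoCK i c).len a * Real.exp (-(δ' * (geoCK i c).dist a a'))) := by
    intro μ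
    rw [mul_assoc]
    refine hasMajorant_mono (g := toB6 (geoCK i c) Rr H) _
      (hasMajorant_mul_of_rowLocal (g := toB6 (geoCK i c) Rr H) (fun p : SiteY i × ι => blkCubeY i c p.1) (fun _ => |(1 : ℝ)| * mb) (hlocE 1)
        (hasMajorant_mul_of_rowLocal (g := toB6 (geoCK i c) Rr H) (fun p : SiteY i × ι => blkCubeY i c p.1) (fun _ => |η| * mb) (hlocRB η μ) (hσ' μ)))
      fun a a' => ?_
    rw [hηabs, abs_one, one_mul]
    have hx : 0 ≤ mb * mb * Real.exp δ' * Real.exp (-(δ' * (geoCK i c).dist a a')) := by positivity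
    calc mb * (η * mb * (Real.exp δ' * Real.exp (-(δ' * (geoCK i c).dist a a')))) = η * (mb * mb * Real.exp δ' * Real.exp (-(δ' * (geoCK i c).dist a a'))) := by
          ring
      _ ≤ (geoCK i c).len a * (mb * mb * Real.exp δ' * Real.exp (-(δ' * (geoCK i c).dist a a'))) := mul_le_mul_of_nonneg_right (hlenη a) hx
      _ = _ := by ring
  ----------------------------------------------------------------
  -- (4) LAPLACIAN: `conj b(Ω₀) − conj b(Ω₀)·conj b(η⁻²avg)·conj b(η²O) − Σ_μ [flux words]·conj b(η²O)`
  ----------------------------------------------------------------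
  have hP1 : HasMajorant (g := toB6 (geoCK i c) Rr H) (fun p : SiteY i × ι => blkCubeY i c p.1) (conj b ((cubeProjY i S).restrictScalars ℝ))
      (fun a a' => mb * 1 * Real.exp (-(δ' * (geoCK i c).dist a a'))) := by
    have h := hasMajorant_mul_of_rowLocal (g := toB6 (geoCK i c) Rr H) (fun p : SiteY i × ι => blkCubeY i c p.1) (fun _ => 1 * mb) hlocP
      (hasMajorant_one_decay i c Rr H (fun p : SiteY i × ι => blkCubeY i c p.1) δ')
    rw [mul_one] at h
    exact hasMajorant_mono (g := toB6 (geoCK i c) Rr H) _ h fun a a' => le_of_eq (by ring)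
  have hPAO : HasMajorant (g := toB6 (geoCK i c) Rr H) (fun p : SiteY i × ι => blkCubeY i c p.1)
      (conj b ((cubeProjY i S).restrictScalars ℝ) * conj b ((((η ^ 2)⁻¹ : ℝ)) • (avgOpY i c par V).restrictScalars ℝ) * conj b ((η ^ 2) • O.restrictScalars ℝ))
      (fun a a' => mb * ((1 + CqK d * (1 / 4)) ^ 2 * mb) * K₁ * 1 * Real.exp (-(δ' * (geoCK i c).dist a a'))) := by
    rw [mul_assoc]
    refine hasMajorant_mono (g := toB6 (geoCK i c) Rr H) _
      (hasMajorant_mul_of_rowLocal (g := toB6 (geoCK i c) Rr H) (fun p : SiteY i × ι => blkCubeY i c p.1) (fun _ => 1 * mb) hlocP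
        (hasMajorant_mul_of_rowLocal (g := toB6 (geoCK i c) Rr H) (fun p : SiteY i × ι => blkCubeY i c p.1)
          (fun a => (1 + CqK d * α₁) ^ 2 * ((geoCK i c).len a ^ 2)⁻¹ * mb) hlocAvg hO))
      fun a a' => ?_
    have hl := geoCK_len_pos i c a
    have e : ((geoCK i c).len a ^ 2)⁻¹ * (geoCK i c).len a ^ 2 = 1 := inv_mul_cancel₀ (pow_ne_zero 2 hl.ne')
    have hCq := CqK_nonneg d
    have hsq : (1 + CqK d * α₁) ^ 2 ≤ (1 + CqK d * (1 / 4)) ^ 2 := by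
      have h0 : 0 ≤ 1 + CqK d * α₁ := by positivity
      have h1 : 1 + CqK d * α₁ ≤ 1 + CqK d * (1 / 4) := by have := mul_le_mul_of_nonneg_left hα14 hCq; linarith
      exact pow_le_pow_left₀ h0 h1 2
    have hrest : 0 ≤ mb * mb * K₁ * Real.exp (-(δ' * (geoCK i c).dist a a')) := by positivity
    calc 1 * mb * ((1 + CqK d * α₁) ^ 2 * ((geoCK i c).len a ^ 2)⁻¹ * mb * (K₁ * (geoCK i c).len a ^ 2 * Real.exp (-(δ' * (geoCK i c).dist a a'))))
        = (1 + CqK d * α₁) ^ 2 * (((geoCK i c).len a ^ 2)⁻¹ * (geoCK i c).len a ^ 2) * (mb * mb * K₁ * Real.exp (-(δ' * (geoCK i c).dist a a'))) := by ring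
      _ ≤ (1 + CqK d * (1 / 4)) ^ 2 * 1 * (mb * mb * K₁ * Real.exp (-(δ' * (geoCK i c).dist a a'))) := by
          rw [e]; exact mul_le_mul_of_nonneg_right (mul_le_mul_of_nonneg_right hsq zero_le_one) hrest
      _ = _ := by ring
  -- `conj b(σ_{±μ})·conj b(η²O)` with the scale transfer
  have hshiftO : ∀ μ, HasMajorant (g := toB6 (geoCK i c) Rr H) (fun p : SiteY i × ι => blkCubeY i c p.1)
      (conj b ((shiftOpY (𝔸 := Matrix (Fin N) (Fin N) ℂ) i μ).restrictScalars ℝ) * conj b ((η ^ 2) • O.restrictScalars ℝ))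
      (fun a a' => Real.exp δ' * K₁ * Λ4 * cB ^ 2 * (geoCK i c).len a ^ 2 * Real.exp (-((1 - 1 / 20) * ((1 - 1 / 20) * δ') * (geoCK i c).dist a a'))) :=
    fun μ => hasMajorant_shift_mul_weighted i c Rr H (fun p : SiteY i × ι => blkCubeY i c p.1) dB (fun a => (geoCK i c).len a ^ 2)
      (Real.exp_nonneg _) hK₁ hΛ4 hpow2 hαδ hρ' (by norm_num) htri hPΛ h261ρ (hσ μ) hO
  have hshiftO' : ∀ μ, HasMajorant (g := toB6 (geoCK i c) Rr H) (fun p : SiteY i × ι => blkCubeY i c p.1)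
      (conj b ((shiftOpY' (𝔸 := Matrix (Fin N) (Fin N) ℂ) i μ).restrictScalars ℝ) * conj b ((η ^ 2) • O.restrictScalars ℝ))
      (fun a a' => Real.exp δ' * K₁ * Λ4 * cB ^ 2 * (geoCK i c).len a ^ 2 * Real.exp (-((1 - 1 / 20) * ((1 - 1 / 20) * δ') * (geoCK i c).dist a a'))) :=
    fun μ => hasMajorant_shift_mul_weighted i c Rr H (fun p : SiteY i × ι => blkCubeY i c p.1) dB (fun a => (geoCK i c).len a ^ 2)
      (Real.exp_nonneg _) hK₁ hΛ4 hpow2 hαδ hρ' (by norm_num) htri hPΛ h261ρ (hσ' μ) hO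
  -- one flux word: `conj b(η⁻²(1 − Ω₀))·conj b(R^{±1})·conj b(σ_{±μ})·conj b(η²O) ≺ K₆·e^{−ρ″d}`
  have hflux : ∀ (Rot Sh : Module.End ℝ (SiteY i × ι → ℝ)),
      (∀ (w : SiteY i × ι → ℝ) (p : SiteY i × ι) (Mb : ℝ), (∀ p' : SiteY i × ι, blkCubeY i c p'.1 = blkCubeY i c p.1 → |w p'| ≤ Mb) → |Rot w p| ≤ |(1 : ℝ)| * mb * Mb) →
      HasMajorant (g := toB6 (geoCK i c) Rr H) (fun p : SiteY i × ι => blkCubeY i c p.1) (Sh * conj b ((η ^ 2) • O.restrictScalars ℝ))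
        (fun a a' => Real.exp δ' * K₁ * Λ4 * cB ^ 2 * (geoCK i c).len a ^ 2 * Real.exp (-((1 - 1 / 20) * ((1 - 1 / 20) * δ') * (geoCK i c).dist a a'))) →
      HasMajorant (g := toB6 (geoCK i c) Rr H) (fun p : SiteY i × ι => blkCubeY i c p.1)
        (conj b (exMul i S ((η ^ 2)⁻¹)) * Rot * Sh * conj b ((η ^ 2) • O.restrictScalars ℝ))
        (fun a a' => K₆ * 1 * Real.exp (-((1 - 1 / 20) * ((1 - 1 / 20) * δ') * (geoCK i c).dist a a'))) := by
    intro Rot Sh hRot hSh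
    rw [mul_assoc, mul_assoc]
    refine hasMajorant_mono (g := toB6 (geoCK i c) Rr H) _
      (hasMajorant_mul_of_rowLocal (g := toB6 (geoCK i c) Rr H) (fun p : SiteY i × ι => blkCubeY i c p.1) (fun a => ((geoCK i c).len a ^ 2)⁻¹ * mb) hlocE2
        (hasMajorant_mul_of_rowLocal (g := toB6 (geoCK i c) Rr H) (fun p : SiteY i × ι => blkCubeY i c p.1) (fun _ => |(1 : ℝ)| * mb) hRot hSh))
      fun a a' => ?_
    have hl := geoCK_len_pos i c a
    have e : ((geoCK i c).len a ^ 2)⁻¹ * (geoCK i c).len a ^ 2 = 1 := inv_mul_cancel₀ (pow_ne_zero 2 hl.ne')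
    rw [abs_one, one_mul, hK₆def]
    refine le_of_eq ?_
    calc ((geoCK i c).len a ^ 2)⁻¹ * mb * (mb * (Real.exp δ' * K₁ * Λ4 * cB ^ 2 * (geoCK i c).len a ^ 2 *
          Real.exp (-((1 - 1 / 20) * ((1 - 1 / 20) * δ') * (geoCK i c).dist a a'))))
        = mb * mb * (Real.exp δ' * K₁ * Λ4 * cB ^ 2) * (((geoCK i c).len a ^ 2)⁻¹ * (geoCK i c).len a ^ 2) *
          Real.exp (-((1 - 1 / 20) * ((1 - 1 / 20) * δ') * (geoCK i c).dist a a')) := by ring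
      _ = mb * mb * (Real.exp δ' * K₁ * Λ4 * cB ^ 2) * 1 * Real.exp (-((1 - 1 / 20) * ((1 - 1 / 20) * δ') * (geoCK i c).dist a a')) := by rw [e]
  have hfluxSum : HasMajorant (g := toB6 (geoCK i c) Rr H) (fun p : SiteY i × ι => blkCubeY i c p.1)
      (∑ μ : Fin (d + 1), (conj b (exMul i S ((η ^ 2)⁻¹)) * conj b (rotB i V 1 μ) * conj b ((shiftOpY' (𝔸 := Matrix (Fin N) (Fin N) ℂ) i μ).restrictScalars ℝ) +
          conj b (exMul i S ((η ^ 2)⁻¹)) * conj b (rotF i V 1 μ) * conj b ((shiftOpY (𝔸 := Matrix (Fin N) (Fin N) ℂ) i μ).restrictScalars ℝ)) *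
        conj b ((η ^ 2) • O.restrictScalars ℝ))
      (fun a a' => (∑ _μ : Fin (d + 1), (K₆ + K₆)) * (1 * Real.exp (-((1 - 1 / 20) * ((1 - 1 / 20) * δ') * (geoCK i c).dist a a')))) := by
    refine hasMajorant_sum_const (g := geoCK i c) (R := Rr) (H := H) (fun p : SiteY i × ι => blkCubeY i c p.1) Finset.univ (fun _ => K₆ + K₆)
      (fun a a' => 1 * Real.exp (-((1 - 1 / 20) * ((1 - 1 / 20) * δ') * (geoCK i c).dist a a'))) fun μ _ => ?_
    rw [add_mul]
    refine hasMajorant_mono (g := toB6 (geoCK i c) Rr H) _ (hasMajorant_add (g := toB6 (geoCK i c) Rr H) _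
      (hflux _ _ (hlocRB 1 μ) (hshiftO' μ)) (hflux _ _ (hlocRF 1 μ) (hshiftO μ))) fun a a' => le_of_eq (by ring)
  ----------------------------------------------------------------
  -- COLLECT at `(B_f, (4/5)δ₀)`
  ----------------------------------------------------------------
  have hd6 : 0 ≤ ((d : ℝ) + 1) * (K₆ + K₆) := mul_nonneg (by positivity) (add_nonneg hK₆ hK₆)
  have hle1 : K₁ ≤ Bf := by rw [hBfdef]; linarith
  have hle2 : B + K₂ + (mb * mb * Real.exp δ' + mb) ≤ Bf := by rw [hBfdef, hK₅def]; linarith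
  have hle3 : B + K₃ + (mb * mb * Real.exp δ' + mb) ≤ Bf := by rw [hBfdef, hK₅def]; linarith
  have hle4 : mb + mb * ((1 + CqK d * (1 / 4)) ^ 2 * mb) * K₁ + ((d : ℝ) + 1) * (K₆ + K₆) ≤ Bf := by rw [hBfdef, hK₄def]; linarith
  refine ⟨hunitV, hasMajorant_weaken i c Rr H _ hpow2 hle1 hBf hrate1 hO, fun μ => ?_, fun μ => ?_, ?_⟩
  · -- (2)
    rw [hOdef, conj_diffLetter_inl_mul_O_eq b i c par hunitV V η μ, hGV, sub_eq_add_neg]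
    refine hasMajorant_mono (g := toB6 (geoCK i c) Rr H) _
      (hasMajorant_add (g := toB6 (geoCK i c) Rr H) _
        (hasMajorant_add (g := toB6 (geoCK i c) Rr H) _ (hasMajorant_weaken i c Rr H _ hlen0 le_rfl (add_nonneg hB hK₂) hrate2 (hVG μ))
          (B9Cor35GpCubeInputsAtOne.hasMajorant_neg (g := toB6 (geoCK i c) Rr H) _
            (hasMajorant_weaken i c Rr H _ hlen0 le_rfl (by positivity) hrate1 (hbdL μ))))
        (hasMajorant_weaken i c Rr H _ hlen0 le_rfl hmb hrate1 hEη)) fun a a' => ?_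
    have hx : 0 ≤ (geoCK i c).len a * Real.exp (-(4 / 5 * δ₀ * (geoCK i c).dist a a')) := mul_nonneg (hlen0 a) (Real.exp_nonneg _)
    have h := mul_le_mul_of_nonneg_right hle2 hx
    linarith [h]
  · -- (3)
    rw [hOdef, conj_O_mul_diffLetter_inr_eq b i c par hunitV V η μ, hGV, sub_eq_add_neg]
    refine hasMajorant_mono (g := toB6 (geoCK i c) Rr H) _
      (hasMajorant_add (g := toB6 (geoCK i c) Rr H) _
        (hasMajorant_add (g := toB6 (geoCK i c) Rr H) _ (hasMajorant_weaken i c Rr H _ hlen0 le_rfl (add_nonneg hB hK₃) hrate2 (hGVR μ))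
          (B9Cor35GpCubeInputsAtOne.hasMajorant_neg (g := toB6 (geoCK i c) Rr H) _ (hasMajorant_weaken i c Rr H _ hlen0 le_rfl hmb hrate1 hEη)))
        (hasMajorant_weaken i c Rr H _ hlen0 le_rfl (by positivity) hrate1 (hbdR μ))) fun a a' => ?_
    have hx : 0 ≤ (geoCK i c).len a * Real.exp (-(4 / 5 * δ₀ * (geoCK i c).dist a a')) := mul_nonneg (hlen0 a) (Real.exp_nonneg _)
    have h := mul_le_mul_of_nonneg_right hle3 hx
    linarith [h]
  · -- (4)
    rw [hOdef, conj_lapSL_mul_O_eq b i c par hunitV hη0, ← hOdef, sub_eq_add_neg, sub_eq_add_neg]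
    have hsumK : (∑ _μ : Fin (d + 1), (K₆ + K₆)) = ((d : ℝ) + 1) * (K₆ + K₆) := by
      rw [Finset.sum_const, Finset.card_univ, Fintype.card_fin, nsmul_eq_mul]; push_cast; ring
    refine hasMajorant_mono (g := toB6 (geoCK i c) Rr H) _
      (hasMajorant_add (g := toB6 (geoCK i c) Rr H) _
        (hasMajorant_add (g := toB6 (geoCK i c) Rr H) _ (hasMajorant_weaken i c Rr H (fun _ => (1 : ℝ)) (fun _ => zero_le_one) le_rfl hmb hrate1 hP1)
          (B9Cor35GpCubeInputsAtOne.hasMajorant_neg (g := toB6 (geoCK i c) Rr H) _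
            (hasMajorant_weaken i c Rr H (fun _ => (1 : ℝ)) (fun _ => zero_le_one) le_rfl (by positivity) hrate1 hPAO)))
        (B9Cor35GpCubeInputsAtOne.hasMajorant_neg (g := toB6 (geoCK i c) Rr H) _
          (hasMajorant_weaken i c Rr H (fun _ => (1 : ℝ)) (fun _ => zero_le_one) le_rfl
            (Finset.sum_nonneg fun _ _ => add_nonneg hK₆ hK₆ : (0 : ℝ) ≤ ∑ _μ : Fin (d + 1), (K₆ + K₆)) hrate2
            (hasMajorant_mono (g := toB6 (geoCK i c) Rr H) _ hfluxSum fun a a' => le_of_eq (by ring)))))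
      fun a a' => ?_
    rw [hsumK]
    have hx : 0 ≤ (1 : ℝ) * Real.exp (-(4 / 5 * δ₀ * (geoCK i c).dist a a')) := by positivity
    have h := mul_le_mul_of_nonneg_right hle4 hx
    linarith [h]

end Main

end Literature.MathematicalPhysics.QuantumFieldTheory.Balaban1983to89.B9Cor36GpDirEntriesAtField

end
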